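import Mathlib.AlgebraicTopology.FundamentalGroupoid.InducedMaps
import Mathlib.AlgebraicTopology.FundamentalGroupoid.FundamentalGroup
import HarnessLib

/-!
# The effect on `π₁` of a map that is homotopic to the inclusion on a subspace: tracks of an
# isotopy, handle slides and handle flips

Topic `Literature/AlgebraicTopology/FundamentalGroup`.  Pure homotopy bookkeeping for the
realisation of automorphisms of `π₁` of a `1`-handlebody by handle slides (Laudenbach–Poénaru
(1972), proof of Lemma 2, the diffeomorphisms `H₂`, `H₃`; consumed through
`Literature/Topology/FourManifolds/SPC4HandlesLemma2Direct.lean`).  Everything is **proved**; no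
definitions, no named facts.

**Setting.**  `i : X → Y` (think: the inclusion of the part `X = {f ≤ a}` of a handlebody `Y`
below its top `1`-handle), `G : Y → Y` (a self-map of the handlebody), and a homotopy
`F : i ≃ G ∘ i` (an isotopy of `X` from the identity to `G|X`, pushed into `Y`) whose track
`t ↦ F(t, z)` at the base point `z ∈ X` is constant.  For `x ∈ X` the *track* of `x` is the
path `τₓ = F(·, x)` in `Y` from `i x` to `G (i x)`; in the statements tracks are any paths
agreeing pointwise with `F(·, x)` (e.g. `F.evalAt x`), so that consumers may use their own
descriptions of them.

* `mk_map_eq_of_homotopy` — **the track formula** (Hatcher (2002), Lemma 1.19: "`φ_{1*} = β_h φ_{0*}`";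
  here for paths with distinct end points, from Mathlib's `Path.Homotopic.map_trans_evalAt`):
  for a path `p` in `X` from `x₁` to `x₂`, `[G ∘ i ∘ p] = [τ_{x₁}]⁻¹ · [i ∘ p] · [τ_{x₂}]`.
* `mapOfEq_mk_map_loop` — `G_#` **is the identity on the classes of loops of `X`** based at `z`
  (the track of `z` being constant).
* `mapOfEq_mk_arcLoop` — **the master formula**: for paths `α₋ : z ⟶ F₋`, `α₊ : z ⟶ F₊` in `X`
  and any path `C : i F₋ ⟶ i F₊` in `Y` (think: the core of the top `1`-handle, running outside
  `X` between its two feet `F₋`, `F₊ ∈ X`),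
  `G_# [i∘α₋ · C · (i∘α₊)⁻¹] = [(i∘α₋ · τ₋) · (G ∘ C) · (i∘α₊ · τ₊)⁻¹]`.
* `mapOfEq_mk_arcLoop_of_slide` — **handle slide** (Laudenbach–Poénaru's `H₃`, p. 340: "we can
  slide the handle `D¹₁ × D³₁` along `D¹₂ × D³₂` … without touching `x₀`"): if moreover `G`
  fixes `C` pointwise, the track of `F₋` is constant and the track of `F₊` is the loop `τ` at
  `i F₊`, then `G_# [i∘α₋ · C · (i∘α₊)⁻¹] = [i∘α₋ · C · (i∘α₊)⁻¹] · [i∘α₊ · τ · (i∘α₊)⁻¹]⁻¹` — the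
  class of the loop through the handle is multiplied by (the inverse of) the class
  `w = [i∘α₊ · τ · (i∘α₊)⁻¹]` of the track, all other generators (classes of loops of `X`) being
  fixed.
* `mapOfEq_mk_arcLoop_of_flip` — **handle flip** (`H₂`, "`Φ₂(x₁) = x₁⁻¹`"): if `G` reverses `C`
  (`G (C s) = C (σ s)`) and the tracks of `F₋`, `F₊` are paths `τ₋ : i F₋ ⟶ i F₊`,
  `τ₊ : i F₊ ⟶ i F₋`, then
  `G_# [i∘α₋ · C · (i∘α₊)⁻¹] = [i∘α₋ · τ₋ · (i∘α₊)⁻¹] · [i∘α₋ · C · (i∘α₊)⁻¹]⁻¹ · [i∘α₋ · τ₊⁻¹ · (i∘α₊)⁻¹]`,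
  of the form `u · x⁻¹ · v` with `u, v` determined by the tracks.

All statements are equalities in `Path.Homotopic.Quotient` (concatenation `·` = `trans`, read
from left to right); recall that in Mathlib's group `FundamentalGroup Y y` the product is
`p * q = q.trans p` (`FundamentalGroup.mul_def`), so "`x · w⁻¹`" above is `w⁻¹ * x` there
(`mapOfEq_arcLoop_eq_mul_of_slide`).

## References

* A. Hatcher, *Algebraic Topology* (2002), §1.1, Lemma 1.19 and the square argument of its
  proof (p. 37); Prop. 1.18. [HatcherAT2002]
* F. Laudenbach, V. Poénaru, *A note on 4-dimensional handlebodies*, Bull. Soc. Math. France 100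
  (1972), proof of Lemma 2, p. 340. [LaudenbachPoenaruBSMF1972]
-/

noncomputable section

open scoped unitInterval
open Set Function

namespace Literature.AlgebraicTopology.FundamentalGroup

namespace IsotopyTrack

variable {X Y : Type*} [TopologicalSpace X] [TopologicalSpace Y]

/-! ### Groupoid bookkeeping in `Path.Homotopic.Quotient` -/

/-- `(p · q)⁻¹ = q⁻¹ · p⁻¹` in the path groupoid. [folklore] -/
theorem quotient_symm_trans {a b c : Y} (p : Path.Homotopic.Quotient a b)
    (q : Path.Homotopic.Quotient b c) : (p.trans q).symm = q.symm.trans p.symm := by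
  induction p using Path.Homotopic.Quotient.ind with | mk p =>
  induction q using Path.Homotopic.Quotient.ind with | mk q =>
  rw [← Path.Homotopic.Quotient.mk_trans, ← Path.Homotopic.Quotient.mk_symm, Path.trans_symm,
    Path.Homotopic.Quotient.mk_trans, Path.Homotopic.Quotient.mk_symm,
    Path.Homotopic.Quotient.mk_symm]

/-- `(p⁻¹)⁻¹ = p` in the path groupoid. [folklore] -/
theorem quotient_symm_symm {a b : Y} (p : Path.Homotopic.Quotient a b) : p.symm.symm = p := by
  induction p using Path.Homotopic.Quotient.ind with | mk p =>
  rw [← Path.Homotopic.Quotient.mk_symm, ← Path.Homotopic.Quotient.mk_symm, Path.symm_symm]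

/-- `p⁻¹ · (p · q) = q` in the path groupoid. [folklore] -/
theorem quotient_symm_trans_trans {a b c : Y} (p : Path.Homotopic.Quotient a b)
    (q : Path.Homotopic.Quotient b c) : p.symm.trans (p.trans q) = q := by
  rw [← Path.Homotopic.Quotient.trans_assoc, Path.Homotopic.Quotient.symm_trans,
    Path.Homotopic.Quotient.refl_trans]

/-- `p · (p⁻¹ · q) = q` in the path groupoid. [folklore] -/
theorem quotient_trans_symm_trans {a b c : Y} (p : Path.Homotopic.Quotient a b)
    (q : Path.Homotopic.Quotient a c) : p.trans (p.symm.trans q) = q := by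
  rw [← Path.Homotopic.Quotient.trans_assoc, Path.Homotopic.Quotient.trans_symm,
    Path.Homotopic.Quotient.refl_trans]

/-- **Conjugating by a constant path and casting back is the identity.**  If `ε` is a path from
`z` to `y` which is pointwise constant (so `y = z` propositionally, but maybe not
syntactically — the situation of the track of a fixed base point under a homotopy `i ≃ G ∘ i`,
a path from `i z` to `G (i z)`), then for every loop class `M` at `z`,
`(ε⁻¹ · M · ε)`, cast to a loop at `z`, is `M`. [folklore] -/
theorem cast_symm_trans_trans_of_forall_eq {z y : Y} (ε : Path z y) (hε : ∀ t, ε t = z)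
    (M : Path.Homotopic.Quotient z z) (h₁ h₂ : z = y) :
    ((Path.Homotopic.Quotient.mk ε).symm.trans (M.trans (Path.Homotopic.Quotient.mk ε))).cast
        h₁ h₂ = M := by
  subst h₁
  have hεr : ε = Path.refl z := Path.ext (funext hε)
  subst hεr
  rw [Path.Homotopic.Quotient.cast_rfl_rfl, ← Path.Homotopic.Quotient.mk_symm, Path.refl_symm,
    Path.Homotopic.Quotient.mk_refl, Path.Homotopic.Quotient.refl_trans,
    Path.Homotopic.Quotient.trans_refl]

/-! ### The track formula -/

/-- **Track formula** (Hatcher (2002), Lemma 1.19 and its proof, for paths): if `F` is a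
homotopy from `f` to `g` and `p` a path in `X` from `x₁` to `x₂`, then in the path groupoid of
`Y`, `[g ∘ p] = [F(·, x₁)]⁻¹ · [f ∘ p] · [F(·, x₂)]` — the image of `p` under `g` is the image
under `f` conjugated by the tracks of the end points (Mathlib's
`Path.Homotopic.map_trans_evalAt`, rearranged). [cite: HatcherAT2002, Lemma 1.19] -/
theorem mk_map_eq_of_homotopy {f g : C(X, Y)} (F : f.Homotopy g) {x₁ x₂ : X} (p : Path x₁ x₂) :
    Path.Homotopic.Quotient.mk (p.map (map_continuous g)) =
      ((Path.Homotopic.Quotient.mk (F.evalAt x₁)).symm.trans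
        (Path.Homotopic.Quotient.mk (p.map (map_continuous f)))).trans
          (Path.Homotopic.Quotient.mk (F.evalAt x₂)) := by
  have h := Path.Homotopic.Quotient.eq.2 (Path.Homotopic.map_trans_evalAt F p)
  rw [Path.Homotopic.Quotient.mk_trans, Path.Homotopic.Quotient.mk_trans] at h
  rw [Path.Homotopic.Quotient.trans_assoc, h, ← Path.Homotopic.Quotient.trans_assoc,
    Path.Homotopic.Quotient.symm_trans, Path.Homotopic.Quotient.refl_trans]

/-! ### Maps homotopic to the inclusion on a subspace -/

section Inclusion

variable (i : C(X, Y)) (G : C(Y, Y)) (F : ContinuousMap.Homotopy i (G.comp i)) {z : X}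

/-- The track formula for a homotopy `F : i ≃ G ∘ i`, with the left-hand side written as
`G ∘ (i ∘ p)` and the tracks given as any paths `τ₁ : i x₁ ⟶ G (i x₁)`, `τ₂ : i x₂ ⟶ G (i x₂)`
agreeing pointwise with `F(·, x₁)`, `F(·, x₂)`. [cite: HatcherAT2002, Lemma 1.19] -/
theorem mk_map_map_eq {x₁ x₂ : X} (p : Path x₁ x₂) (τ₁ : Path (i x₁) (G (i x₁)))
    (τ₂ : Path (i x₂) (G (i x₂))) (h₁ : ∀ t, τ₁ t = F (t, x₁)) (h₂ : ∀ t, τ₂ t = F (t, x₂)) :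
    Path.Homotopic.Quotient.mk ((p.map (map_continuous i)).map (map_continuous G)) =
      ((Path.Homotopic.Quotient.mk τ₁).symm.trans
        (Path.Homotopic.Quotient.mk (p.map (map_continuous i)))).trans
          (Path.Homotopic.Quotient.mk τ₂) := by
  have e₁ : τ₁ = F.evalAt x₁ := Path.ext (funext h₁)
  have e₂ : τ₂ = F.evalAt x₂ := Path.ext (funext h₂)
  subst e₁ e₂
  exact mk_map_eq_of_homotopy F p

/-- **`G_#` fixes the classes coming from `X`.**  Let `F : i ≃ G ∘ i` be a homotopy whose track at
`z` is constant.  Then for every loop `β` of `X` at `z`, `G_# [i ∘ β] = [i ∘ β]` in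
`π₁(Y, i z)` (Hatcher (2002), Lemma 1.19 with a constant track). [cite: HatcherAT2002, Lemma 1.19] -/
theorem mapOfEq_mk_map_loop (hfix : ∀ t, F (t, z) = i z) (hGz : G (i z) = i z) (β : Path z z) :
    FundamentalGroup.mapOfEq G hGz
        (FundamentalGroup.fromPath (Path.Homotopic.Quotient.mk (β.map (map_continuous i)))) =
      FundamentalGroup.fromPath (Path.Homotopic.Quotient.mk (β.map (map_continuous i))) := by
  set ε : Path (i z) (G (i z)) := F.evalAt z with hε
  rw [FundamentalGroup.mapOfEq_apply]
  change (Path.Homotopic.Quotient.map (Path.Homotopic.Quotient.mk (β.map (map_continuous i))) G).cast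
      hGz.symm hGz.symm = Path.Homotopic.Quotient.mk (β.map (map_continuous i))
  rw [← Path.Homotopic.Quotient.mk_map, mk_map_map_eq i G F β ε ε (fun _ => rfl) (fun _ => rfl),
    Path.Homotopic.Quotient.trans_assoc]
  exact cast_symm_trans_trans_of_forall_eq ε hfix _ _ _

/-- **Master formula for the loop through an arc.**  Let `F : i ≃ G ∘ i` be a homotopy whose
track at `z` is constant, `α₋`, `α₊` paths in `X` from `z` to `F₋`, `F₊`, `C` any path in `Y`
from `i F₋` to `i F₊`, and `τ₋ : i F₋ ⟶ G (i F₋)`, `τ₊ : i F₊ ⟶ G (i F₊)` the tracks of the end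
points (any paths agreeing pointwise with `F(·, F₋)`, `F(·, F₊)`).  Then
`G_# [i∘α₋ · C · (i∘α₊)⁻¹] = [(i∘α₋ · τ₋) · (G ∘ C) · (i∘α₊ · τ₊)⁻¹]` in `π₁(Y, i z)` (the square
argument of Hatcher (2002), Lemma 1.19, applied to `α₋` and `α₊`; the constant track of `z`
cancels). [cite: HatcherAT2002, Lemma 1.19] -/
theorem mapOfEq_mk_arcLoop (hfix : ∀ t, F (t, z) = i z) (hGz : G (i z) = i z) {Fm Fp : X}
    (αm : Path z Fm) (αp : Path z Fp) (C : Path (i Fm) (i Fp))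
    (τm : Path (i Fm) (G (i Fm))) (τp : Path (i Fp) (G (i Fp)))
    (hτm : ∀ t, τm t = F (t, Fm)) (hτp : ∀ t, τp t = F (t, Fp)) :
    FundamentalGroup.mapOfEq G hGz
        (FundamentalGroup.fromPath (Path.Homotopic.Quotient.mk
          (((αm.map (map_continuous i)).trans C).trans (αp.map (map_continuous i)).symm))) =
      FundamentalGroup.fromPath (Path.Homotopic.Quotient.mk
        ((((αm.map (map_continuous i)).trans τm).trans (C.map (map_continuous G))).trans
          ((αp.map (map_continuous i)).trans τp).symm)) := by
  set ε : Path (i z) (G (i z)) := F.evalAt z with hε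
  rw [FundamentalGroup.mapOfEq_apply]
  change (Path.Homotopic.Quotient.map (Path.Homotopic.Quotient.mk
      (((αm.map (map_continuous i)).trans C).trans (αp.map (map_continuous i)).symm)) G).cast
        hGz.symm hGz.symm =
    Path.Homotopic.Quotient.mk
      ((((αm.map (map_continuous i)).trans τm).trans (C.map (map_continuous G))).trans
        ((αp.map (map_continuous i)).trans τp).symm)
  rw [← Path.Homotopic.Quotient.mk_map, Path.map_trans, Path.map_trans, ← Path.map_symm]
  simp only [Path.Homotopic.Quotient.mk_trans, Path.Homotopic.Quotient.mk_symm,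
    mk_map_map_eq i G F αm ε τm (fun _ => rfl) hτm, mk_map_map_eq i G F αp ε τp (fun _ => rfl) hτp,
    quotient_symm_trans, quotient_symm_symm, Path.Homotopic.Quotient.trans_assoc]
  -- fold `… · ε` and cancel the constant track `ε = F(·, z)`
  set E := Path.Homotopic.Quotient.mk ε
  set Am := Path.Homotopic.Quotient.mk (αm.map (map_continuous i))
  set Ap := Path.Homotopic.Quotient.mk (αp.map (map_continuous i))
  set Tm := Path.Homotopic.Quotient.mk τm
  set Tp := Path.Homotopic.Quotient.mk τp
  set CG := Path.Homotopic.Quotient.mk (C.map (map_continuous G))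
  rw [show Am.trans (Tm.trans (CG.trans (Tp.symm.trans (Ap.symm.trans E)))) =
      (Am.trans (Tm.trans (CG.trans (Tp.symm.trans Ap.symm)))).trans E by
    simp only [Path.Homotopic.Quotient.trans_assoc]]
  exact cast_symm_trans_trans_of_forall_eq ε hfix _ _ _

/-- Bookkeeping for the slide formula: if `τm` is constant, `CG = C` and `τp = τ` pointwise
(their end points being equal only propositionally), then `τm · CG · τp⁻¹ · Q = C · τ⁻¹ · Q`
(proved by substituting the end-point equalities). [folklore] -/
theorem trans_eq_of_forall_eq_slide {u v u' v' w : Y} (hu : u' = u) (hv : v' = v)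
    (τm : Path u u') (CG : Path u' v') (τp : Path v v') (C : Path u v) (τ : Path v v)
    (hτm : ∀ t, τm t = u) (hCG : ∀ t, CG t = C t) (hτp : ∀ t, τp t = τ t)
    (Q : Path.Homotopic.Quotient v w) :
    (Path.Homotopic.Quotient.mk τm).trans ((Path.Homotopic.Quotient.mk CG).trans
        ((Path.Homotopic.Quotient.mk τp).symm.trans Q)) =
      (Path.Homotopic.Quotient.mk C).trans ((Path.Homotopic.Quotient.mk τ).symm.trans Q) := by
  subst hu hv
  have h1 : τm = Path.refl _ := Path.ext (funext hτm)
  have h2 : CG = C := Path.ext (funext hCG)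
  have h3 : τp = τ := Path.ext (funext hτp)
  subst h1 h2 h3
  rw [Path.Homotopic.Quotient.mk_refl, Path.Homotopic.Quotient.refl_trans]

/-- **Handle slide.**  In the situation of `mapOfEq_mk_arcLoop` assume that `G` fixes the arc
`C` pointwise, that the track of `F₋` is constant, and that the track of `F₊` is the loop `τ`
at `i F₊` (`F(t, F₊) = τ t`).  Then
`G_# [i∘α₋ · C · (i∘α₊)⁻¹] = [i∘α₋ · C · (i∘α₊)⁻¹] · [i∘α₊ · τ · (i∘α₊)⁻¹]⁻¹`:
the class of the loop through the arc is multiplied on the right (in the order of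
concatenation) by the inverse of the class `w` of the track of the moving foot, and
(`mapOfEq_mk_map_loop`) the classes of loops of `X` are fixed — the effect `x₁ ↦ x₁ x₂` (up to
the side and sign conventions) of Laudenbach–Poénaru's slide `H₃` of one foot of the first
handle once over the second handle, p. 340. [cite: LaudenbachPoenaruBSMF1972, §2, proof of Lemma 2 (p. 340)]
[cite: HatcherAT2002, Lemma 1.19] -/
theorem mapOfEq_mk_arcLoop_of_slide (hfix : ∀ t, F (t, z) = i z) (hGz : G (i z) = i z)
    {Fm Fp : X} (αm : Path z Fm) (αp : Path z Fp) (C : Path (i Fm) (i Fp))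
    (hC : ∀ s, G (C s) = C s) (hFm : ∀ t, F (t, Fm) = i Fm) (τ : Path (i Fp) (i Fp))
    (hτ : ∀ t, F (t, Fp) = τ t) :
    FundamentalGroup.mapOfEq G hGz
        (FundamentalGroup.fromPath (Path.Homotopic.Quotient.mk
          (((αm.map (map_continuous i)).trans C).trans (αp.map (map_continuous i)).symm))) =
      FundamentalGroup.fromPath
        ((Path.Homotopic.Quotient.mk
          (((αm.map (map_continuous i)).trans C).trans (αp.map (map_continuous i)).symm)).trans
         (Path.Homotopic.Quotient.mk
          (((αp.map (map_continuous i)).trans τ).trans (αp.map (map_continuous i)).symm)).symm) := by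
  set τm : Path (i Fm) (G (i Fm)) := F.evalAt Fm with hτm
  set τp : Path (i Fp) (G (i Fp)) := F.evalAt Fp with hτp
  rw [mapOfEq_mk_arcLoop i G F hfix hGz αm αp C τm τp (fun _ => rfl) (fun _ => rfl)]
  have hGp : G (i Fp) = i Fp := by
    have h := hτ 1
    rwa [F.apply_one, ContinuousMap.comp_apply, τ.target] at h
  have hGm : G (i Fm) = i Fm := by
    have h := hFm 1
    rwa [F.apply_one, ContinuousMap.comp_apply] at h
  change Path.Homotopic.Quotient.mk _ =
    Path.Homotopic.Quotient.trans (Path.Homotopic.Quotient.mk _) (Path.Homotopic.Quotient.mk _).symm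
  simp only [Path.Homotopic.Quotient.mk_trans, Path.Homotopic.Quotient.mk_symm,
    Path.Homotopic.Quotient.trans_assoc, quotient_symm_trans, quotient_symm_symm,
    quotient_symm_trans_trans,
    trans_eq_of_forall_eq_slide hGm hGp τm (C.map (map_continuous G)) τp C τ
      (fun t => hFm t) (fun t => hC t) (fun t => hτ t)]

/-- **The slide in the group `π₁(Y, i z)`**: with Mathlib's multiplication on `FundamentalGroup`
(`p * q = q.trans p`), the conclusion of `mapOfEq_mk_arcLoop_of_slide` reads
`G_# x = w⁻¹ * x`, where `x = [i∘α₋ · C · (i∘α₊)⁻¹]` is the class of the loop through the arc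
and `w = [i∘α₊ · τ · (i∘α₊)⁻¹]` that of the track of the moving foot.
[cite: LaudenbachPoenaruBSMF1972, §2, proof of Lemma 2 (p. 340)] -/
theorem mapOfEq_arcLoop_eq_mul_of_slide (hfix : ∀ t, F (t, z) = i z) (hGz : G (i z) = i z)
    {Fm Fp : X} (αm : Path z Fm) (αp : Path z Fp) (C : Path (i Fm) (i Fp))
    (hC : ∀ s, G (C s) = C s) (hFm : ∀ t, F (t, Fm) = i Fm) (τ : Path (i Fp) (i Fp))
    (hτ : ∀ t, F (t, Fp) = τ t) :
    FundamentalGroup.mapOfEq G hGz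
        (FundamentalGroup.fromPath (Path.Homotopic.Quotient.mk
          (((αm.map (map_continuous i)).trans C).trans (αp.map (map_continuous i)).symm))) =
      (FundamentalGroup.fromPath (Path.Homotopic.Quotient.mk
          (((αp.map (map_continuous i)).trans τ).trans (αp.map (map_continuous i)).symm)))⁻¹ *
        FundamentalGroup.fromPath (Path.Homotopic.Quotient.mk
          (((αm.map (map_continuous i)).trans C).trans (αp.map (map_continuous i)).symm)) := by
  rw [mapOfEq_mk_arcLoop_of_slide i G F hfix hGz αm αp C hC hFm τ hτ, FundamentalGroup.mul_def,
    FundamentalGroup.inv_def]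

/-- Bookkeeping for the flip formula: if `CG` is `C` reversed and `τm`, `τp` are the given paths
pointwise (end points equal only propositionally), then
`τm · CG · τp⁻¹ · Q = τ₋ · C⁻¹ · τ₊⁻¹ · Q`. [folklore] -/
theorem trans_eq_of_forall_eq_flip {u v u' v' w : Y} (hu : u' = v) (hv : v' = u)
    (τm : Path u u') (CG : Path u' v') (τp : Path v v') (C : Path u v) (tm : Path u v)
    (tp : Path v u) (hτm : ∀ t, τm t = tm t) (hCG : ∀ t, CG t = C.symm t) (hτp : ∀ t, τp t = tp t)
    (Q : Path.Homotopic.Quotient v w) :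
    (Path.Homotopic.Quotient.mk τm).trans ((Path.Homotopic.Quotient.mk CG).trans
        ((Path.Homotopic.Quotient.mk τp).symm.trans Q)) =
      (Path.Homotopic.Quotient.mk tm).trans ((Path.Homotopic.Quotient.mk C).symm.trans
        ((Path.Homotopic.Quotient.mk tp).symm.trans Q)) := by
  subst hu hv
  have h1 : τm = tm := Path.ext (funext hτm)
  have h2 : CG = C.symm := Path.ext (funext hCG)
  have h3 : τp = tp := Path.ext (funext hτp)
  subst h1 h2 h3
  rw [Path.Homotopic.Quotient.mk_symm]

/-- **Handle flip.**  In the situation of `mapOfEq_mk_arcLoop` assume that `G` reverses the arc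
(`G (C s) = C (σ s)`), and that the tracks of `F₋`, `F₊` are (pointwise) the paths
`τ₋ : i F₋ ⟶ i F₊`, `τ₊ : i F₊ ⟶ i F₋` exchanging the feet.  Then
`G_# [i∘α₋ · C · (i∘α₊)⁻¹] = [i∘α₋ · τ₋ · (i∘α₊)⁻¹] · [i∘α₋ · C · (i∘α₊)⁻¹]⁻¹ · [i∘α₋ · τ₊⁻¹ · (i∘α₊)⁻¹]`
— of the form `u · x⁻¹ · v` with `u`, `v` built from the tracks, the class of the loop through
the handle being inverted: Laudenbach–Poénaru's `H₂` ("`Φ₂(x₁) = x₁⁻¹`, `Φ₂(xᵢ) = xᵢ` if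
`i > 1`", p. 339, "an elementary exercise", p. 340), up to the correction terms `u, v`, which
are trivial when the exchange of the feet runs inside a simply connected part of `i(X)`.
[cite: LaudenbachPoenaruBSMF1972, §2, proof of Lemma 2 (pp. 339–340)] [cite: HatcherAT2002, Lemma 1.19] -/
theorem mapOfEq_mk_arcLoop_of_flip (hfix : ∀ t, F (t, z) = i z) (hGz : G (i z) = i z)
    {Fm Fp : X} (αm : Path z Fm) (αp : Path z Fp) (C : Path (i Fm) (i Fp))
    (hC : ∀ s, G (C s) = C (σ s)) (tm : Path (i Fm) (i Fp)) (htm : ∀ t, F (t, Fm) = tm t)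
    (tp : Path (i Fp) (i Fm)) (htp : ∀ t, F (t, Fp) = tp t) :
    FundamentalGroup.mapOfEq G hGz
        (FundamentalGroup.fromPath (Path.Homotopic.Quotient.mk
          (((αm.map (map_continuous i)).trans C).trans (αp.map (map_continuous i)).symm))) =
      FundamentalGroup.fromPath
        (((Path.Homotopic.Quotient.mk
            (((αm.map (map_continuous i)).trans tm).trans (αp.map (map_continuous i)).symm)).trans
          (Path.Homotopic.Quotient.mk
            (((αm.map (map_continuous i)).trans C).trans (αp.map (map_continuous i)).symm)).symm).trans
          (Path.Homotopic.Quotient.mk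
            (((αm.map (map_continuous i)).trans tp.symm).trans (αp.map (map_continuous i)).symm))) := by
  set τm : Path (i Fm) (G (i Fm)) := F.evalAt Fm with hτm
  set τp : Path (i Fp) (G (i Fp)) := F.evalAt Fp with hτp
  rw [mapOfEq_mk_arcLoop i G F hfix hGz αm αp C τm τp (fun _ => rfl) (fun _ => rfl)]
  have hGp : G (i Fp) = i Fm := by
    have h := htp 1
    rwa [F.apply_one, ContinuousMap.comp_apply, tp.target] at h
  have hGm : G (i Fm) = i Fp := by
    have h := htm 1
    rwa [F.apply_one, ContinuousMap.comp_apply, tm.target] at h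
  change Path.Homotopic.Quotient.mk _ =
    Path.Homotopic.Quotient.trans (Path.Homotopic.Quotient.trans (Path.Homotopic.Quotient.mk _)
      (Path.Homotopic.Quotient.mk _).symm) (Path.Homotopic.Quotient.mk _)
  simp only [Path.Homotopic.Quotient.mk_trans, Path.Homotopic.Quotient.mk_symm,
    Path.Homotopic.Quotient.trans_assoc, quotient_symm_trans, quotient_symm_symm,
    quotient_symm_trans_trans,
    trans_eq_of_forall_eq_flip hGm hGp τm (C.map (map_continuous G)) τp C tm tp
      (fun t => htm t) (fun t => hC t) (fun t => htp t)]

end Inclusion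

end IsotopyTrack

end Literature.AlgebraicTopology.FundamentalGroup
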